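import Literature.Probability.RandomPlanarGeometry.SAWCountMonotoneSharpEven
import Literature.Probability.RandomPlanarGeometry.SAWCountMonotoneEscape
import HarnessLib

/-!
# Walks trapped at BOTH ends exist at every even length `n ≥ 8d - 4`: the escape residual is
# nonempty there, in every dimension `d ≥ 2`

Companion of `SAWCountMonotoneEscapeSharp.lean` (odd lengths `n ≥ 6d - 1`, via the odd witness with its
free start site visited first).  Here the even lengths, by a generic DETOUR: if an `n`-step walk `ω` has a
trapped end and all start neighbours but `p` visited, and `q ∉ ω` is a common neighbour of `p` and `ω 1`,
then `0, p, q, ω 1, ω 2, …, ω n` is an `(n+2)`-step walk trapped at both ends (`detourWalk`,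
`detourWalk_mem_bothTrapped`).  Applied to the even witnesses of `SAWCountMonotoneSharpEven.lean` (free
start site `-e₁`; detour `0, -e₁, ±e₀ - e₁, ±e₀`; no witness site has a negative second coordinate):

* `escapeResidual_nonempty_of_even` : **`R(d, n) ≠ ∅` for every `d ≥ 2` and every even `n ≥ 8d - 4`**
  (with the odd case of `SAWCountMonotoneEscapeSharp.lean`: the escape route can prove O'Brien's inequality
  only for odd `n ≤ 6d - 3` and even `n ≤ 8d - 6`; exhaustive enumeration, kit j306921/j307755: on `ℤ²` and
  `ℤ³` it does exactly that — `R(2, n) = ∅` iff `n ≤ 10`; `R(3, n) = ∅` for `n ≤ 16` and `n = 18`,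
  `#R(3,17) = 2736`, `#R(3,19) = 122208`, `#R(3,20) = 43200`; data not used in proofs).

[cite: MadrasSlade1993, §1.1; §7.1 p. 231 (`c_{N+1} ≥ c_N`, O'Brien)] [cite: BDGS2012, §1.3 (`cₙ ≤ cₙ₊₁`, O'Brien 1990)]
-/

noncomputable section

open Literature.Probability.LatticeModels Literature.Probability.Percolation SimpleGraph

namespace Literature.Probability.RandomPlanarGeometry.SAW.Zd

variable {d : ℕ}

/-! ### The detour through the last free start site -/

/-- The **detour** `0, p, q, ω 1, …, ω n`: two new sites spliced in after the origin. [cite: BDGS2012, §1.3] -/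
def detourWalk (ω : ℕ → Site d) (p q : Site d) (t : ℕ) : Site d :=
  if t = 0 then 0 else if t = 1 then p else if t = 2 then q else ω (t - 2)

/-- From time `3` on the detour is `ω` shifted by two. [cite: BDGS2012, §1.3] -/
theorem detourWalk_of_three_le {ω : ℕ → Site d} {p q : Site d} {t : ℕ} (ht : 3 ≤ t) :
    detourWalk ω p q t = ω (t - 2) := by
  simp [detourWalk, show t ≠ 0 by omega, show t ≠ 1 by omega, show t ≠ 2 by omega]

/-- Every site of `ω` on `[0, n]` is a site of the detour on `[0, n + 2]`. [cite: BDGS2012, §1.3] -/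
theorem exists_detourWalk_eq {ω : ℕ → Site d} {p q : Site d} {n : ℕ} (hω : ω ∈ saws d n) {s : ℕ}
    (hs : s < n + 1) : ∃ i < n + 2 + 1, detourWalk ω p q i = ω s := by
  rcases Nat.eq_zero_or_pos s with rfl | hs0
  · exact ⟨0, by omega, by simp [detourWalk, (mem_saws.1 hω).1]⟩
  · exact ⟨s + 2, by omega, by rw [detourWalk_of_three_le (by omega), Nat.add_sub_cancel]⟩

/-- **The detour is an `(n+2)`-step self-avoiding walk** when `p ∼ 0`, `q ∼ p`, `q ∼ ω 1`, `p ≠ q`, and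
neither `p` nor `q` is a site of `ω`. [cite: MadrasSlade1993, §1.1] -/
theorem detourWalk_mem_saws {ω : ℕ → Site d} {p q : Site d} {n : ℕ} (hω : ω ∈ saws d n) (hn : 1 ≤ n)
    (h0p : (zdGraph d).Adj 0 p) (hpq : (zdGraph d).Adj p q) (hq1 : (zdGraph d).Adj q (ω 1)) (hne : p ≠ q)
    (hp : ∀ i ≤ n, ω i ≠ p) (hq : ∀ i ≤ n, ω i ≠ q) : detourWalk ω p q ∈ saws d (n + 2) := by
  obtain ⟨h0, hend, hadj, hinj⟩ := mem_saws.1 hω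
  refine mem_saws_of_forall (by simp [detourWalk]) (fun i hi => ?_) (fun i hi => ?_) ?_
  · rw [detourWalk_of_three_le (by omega), detourWalk_of_three_le (by omega), hend (i - 2) (by omega),
      show n + 2 - 2 = n by omega]
  · rcases Nat.lt_or_ge i 3 with h | h
    · interval_cases i
      · simpa [detourWalk] using h0p
      · simpa [detourWalk] using hpq
      · rw [show detourWalk ω p q 2 = q by simp [detourWalk], detourWalk_of_three_le le_rfl]; exact hq1
    · rw [detourWalk_of_three_le h, detourWalk_of_three_le (by omega), show i + 1 - 2 = (i - 2) + 1 by omega]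
      exact hadj (i - 2) (by omega)
  · -- no repeated site
    intro i hi j hj hij
    have key : ∀ a b, a < b → b < n + 2 + 1 → detourWalk ω p q a ≠ detourWalk ω p q b := by
      intro a b hab hb heq
      rcases Nat.lt_or_ge b 3 with hb3 | hb3
      · interval_cases b <;> interval_cases a <;> simp [detourWalk] at heq
        · exact (h0p.ne heq).elim
        · rw [← h0] at heq; exact hq 0 (by omega) heq
        · exact hne heq
      · rw [detourWalk_of_three_le hb3] at heq
        rcases Nat.lt_or_ge a 3 with ha3 | ha3
        · interval_cases a
          · simp only [detourWalk, if_true] at heq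
            rw [← h0] at heq
            have := hinj (by simp) (by simp only [Set.mem_setOf_eq]; omega) heq
            omega
          · exact hp (b - 2) (by omega) (by simpa [detourWalk] using heq.symm)
          · exact hq (b - 2) (by omega) (by simpa [detourWalk] using heq.symm)
        · rw [detourWalk_of_three_le ha3] at heq
          have := hinj (by simp only [Set.mem_setOf_eq]; omega) (by simp only [Set.mem_setOf_eq]; omega) heq
          omega
    rcases lt_trichotomy i j with h | h | h
    · exact absurd hij (key i j h hj)
    · exact h
    · exact absurd hij.symm (key j i h hi)

open Classical in
/-- **The detour is trapped at both ends** when `ω` has a trapped end and every neighbour of the origin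
other than `p` is a site of `ω`: it lies in the escape residual. [cite: BDGS2012, §1.3] -/
theorem detourWalk_mem_escapeResidual {ω : ℕ → Site d} {p q : Site d} {n : ℕ} (hω : ω ∈ saws d n)
    (hn : 1 ≤ n) (h0p : (zdGraph d).Adj 0 p) (hpq : (zdGraph d).Adj p q) (hq1 : (zdGraph d).Adj q (ω 1))
    (hne : p ≠ q) (hp : ∀ i ≤ n, ω i ≠ p) (hq : ∀ i ≤ n, ω i ≠ q) (htrap : extCount ω n = 0)
    (hstart : ∀ a : Fin d, ((∃ i < n + 1, ω i = Pi.single a 1) ∨ (Pi.single a 1 : Site d) = p) ∧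
      ((∃ i < n + 1, ω i = -Pi.single a 1) ∨ -(Pi.single a 1 : Site d) = p)) :
    detourWalk ω p q ∈ escapeResidual d (n + 2) := by
  have hsaw := detourWalk_mem_saws hω hn h0p hpq hq1 hne hp hq
  have hend : detourWalk ω p q (n + 2) = ω n := by rw [detourWalk_of_three_le (by omega), Nat.add_sub_cancel]
  refine bothTrapped_subset_escapeResidual d (n + 2) (Finset.mem_filter.2 ⟨hsaw, ?_, ?_⟩)
  · -- trapped end: a free neighbour of the detour's end would be a free neighbour of `ω n`
    rw [extCount, Finset.card_eq_zero, Finset.eq_empty_iff_forall_notMem]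
    intro y hy
    obtain ⟨hya, hyf⟩ := mem_freeNbrs.1 hy
    rw [hend] at hya
    have : y ∈ freeNbrs ω n := by
      refine mem_freeNbrs.2 ⟨hya, fun i hi h => ?_⟩
      obtain ⟨i', hi', e⟩ := exists_detourWalk_eq (p := p) (q := q) hω (s := i) (by omega)
      exact hyf i' (by omega) (e.trans h)
    rw [extCount, Finset.card_eq_zero] at htrap
    rw [htrap] at this
    simp at this
  · -- surrounded start: every `± eₐ` is a site of the detour (a site of `ω`, or `p` itself at time `1`)
    have hvis : ∀ a : Fin d, (∃ i < n + 2 + 1, detourWalk ω p q i = Pi.single a 1) ∧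
        (∃ i < n + 2 + 1, detourWalk ω p q i = -Pi.single a 1) := by
      intro a
      constructor
      · rcases (hstart a).1 with ⟨i, hi, e⟩ | e
        · obtain ⟨i', hi', e'⟩ := exists_detourWalk_eq (p := p) (q := q) hω hi
          exact ⟨i', hi', e'.trans e⟩
        · exact ⟨1, by omega, by simp [detourWalk, e]⟩
      · rcases (hstart a).2 with ⟨i, hi, e⟩ | e
        · obtain ⟨i', hi', e'⟩ := exists_detourWalk_eq (p := p) (q := q) hω hi
          exact ⟨i', hi', e'.trans e⟩
        · exact ⟨1, by omega, by simp [detourWalk, e]⟩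
    have hd0 : detourWalk ω p q 0 = 0 := by simp [detourWalk]
    rw [extCount, Finset.card_eq_zero, Finset.eq_empty_iff_forall_notMem]
    intro y hy
    rw [mem_freeNbrs_revWalk hsaw, hd0] at hy
    obtain ⟨hadj, hfree⟩ := hy
    obtain ⟨a, ha | ha⟩ := (zdGraph_adj_iff _ _).1 hadj
    · rw [zero_add] at ha
      obtain ⟨i, hi, hiy⟩ := (hvis a).1
      exact hfree i (by omega) (hiy.trans ha.symm)
    · have ha' : detourWalk ω p q (n + 2) - y = -(Pi.single a 1 : Site d) := eq_neg_of_add_eq_zero_left ha.symm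
      obtain ⟨i, hi, hiy⟩ := (hvis a).2
      exact hfree i (by omega) (hiy.trans ha'.symm)

/-! ### The even witnesses have no site below the plane `x₁ = 0` -/

section EvenNonneg

variable {m k : ℕ}

/-- Every site of the even witness has second coordinate `≥ 0`. [cite: BDGS2012, §1.3] -/
theorem planeCoord_evenWitness_nonneg (t : ℕ) : 0 ≤ planeCoord (m + 1) (evenWitness m k t) := by
  rcases Nat.lt_or_ge t (2 * k + 8 * m + 18) with ht | ht
  · rcases evenWitness_zones (m := m) (k := k) (t := t) ht.le with
        hA | ⟨hB1, hB2⟩ | ⟨s, hs, rfl⟩ | ⟨j, r, hj1, hj2, hr, rfl⟩ | hE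
    · rw [evenWitness_of_le hA, planeCoord_spinePt]
    · rw [evenWitness_leg hB1 hB2, planeCoord_add, planeCoord_spinePt, planeCoord_planeVec]; norm_num
    · rw [evenWitness_head hs, planeCoord_evenHead]; split_ifs <;> norm_num
    · rw [evenWitness_petal hj1 hj2 hr, planeCoord_evenPetal (by omega) hj2]; split_ifs <;> norm_num
    · omega
  · rw [evenWitness_of_ge ht, planeCoord_evenEnd]; norm_num

/-- Every site of the planar even witness has second coordinate `≥ 0`. [cite: BDGS2012, §1.3] -/
theorem planeCoord_evenWitnessTwo_nonneg (t : ℕ) : 0 ≤ planeCoord 0 (evenWitnessTwo k t) := by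
  rcases Nat.lt_or_ge t 7 with h7 | h7
  · rw [evenWitnessTwo_head (by omega), (coords_evenHeadTwo t).2]; split_ifs <;> norm_num
  rcases Nat.lt_or_ge t (k + 8) with h8 | h8
  · rw [evenWitnessTwo_out h7 (by omega), planeCoord_add, planeCoord_spinePt, planeCoord_planeVec]; norm_num
  rcases Nat.lt_or_ge t (2 * k + 10) with h10 | h10
  · rw [evenWitnessTwo_back h8 (by omega), planeCoord_spinePt]
  · rw [evenWitnessTwo_of_ge h10, planeCoord_add, planeCoord_spinePt, planeCoord_planeVec]; norm_num

end EvenNonneg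

/-! ### The both-trapped even witnesses -/

section EvenBoth

variable {m k : ℕ}

/-- **The both-trapped even witness** on `ℤ^{m+3}`: detour `0, -e₁, e₀ - e₁, e₀`, then the even witness;
length `8m + 20 + 2k = 8d - 4 + 2k`. [cite: BDGS2012, §1.3] -/
def bothTrappedEvenWitness (m k : ℕ) : ℕ → Site (m + 1 + 2) :=
  detourWalk (evenWitness m k) (-planeVec (m + 1)) (spinePt (m + 1) 1 + -planeVec (m + 1))

/-- It lies in the escape residual `R(m+3, 8m + 20 + 2k)`. [cite: BDGS2012, §1.3] -/
theorem bothTrappedEvenWitness_mem_escapeResidual (m k : ℕ) :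
    bothTrappedEvenWitness m k ∈ escapeResidual (m + 1 + 2) (2 * k + 8 * m + 18 + 2) := by
  have hT := evenWitness_mem_doublyTrapped m k
  obtain ⟨hsaw, htrap, -⟩ := mem_doublyTrapped.1 hT
  have hneg : ∀ t, evenWitness m k t ≠ -planeVec (m + 1) ∧
      evenWitness m k t ≠ spinePt (m + 1) 1 + -planeVec (m + 1) := fun t => by
    have h := planeCoord_evenWitness_nonneg (m := m) (k := k) t
    constructor <;> intro e <;> rw [e] at h <;> simp at h
  refine detourWalk_mem_escapeResidual hsaw (by omega) ?_ ?_ ?_ ?_ (fun i _ => (hneg i).1) (fun i _ => (hneg i).2)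
    htrap ?_
  · -- `0 ∼ -e₁`
    have h := adj_add_planeVec' (m := m + 1) (-planeVec (m + 1))
    rwa [neg_add_cancel] at h
  · -- `-e₁ ∼ e₀ - e₁`
    rw [add_comm (spinePt (m + 1) 1) (-planeVec (m + 1))]; exact adj_add_spinePt_one _
  · -- `e₀ - e₁ ∼ e₀ = evenWitness 1`
    rw [evenWitness_of_le (by omega), show ((1 : ℕ) : ℤ) = 1 by rfl]
    have h := adj_add_planeVec' (m := m + 1) (spinePt (m + 1) 1 + -planeVec (m + 1))
    rw [add_assoc (spinePt (m + 1) 1) (-planeVec (m + 1)) (planeVec (m + 1)), neg_add_cancel, add_zero] at h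
    exact h.symm
  · intro e
    have := congrArg (spineCoord (m + 1)) e
    simp at this
  · -- start neighbours: all but `-e₁` are sites of the even witness
    intro a
    obtain ⟨-, v1, -, v3, -, -, -, -, -, v9, -, -, -, -⟩ := evenHead_values (m := m)
    rcases single_eq_evenLat (m := m) a with ⟨-, ha⟩ | ⟨-, ha⟩ | ⟨ha1, ha, ha'⟩
    · rw [ha]
      refine ⟨Or.inl ⟨1, by omega, ?_⟩, Or.inl ⟨2 * k + 4 + 9, by omega, ?_⟩⟩
      · rw [evenWitness_of_le (by omega)]; simp
      · rw [evenWitness_head (by omega), v9]; simp only [spinePt, Pi.single_neg]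
    · rw [ha]
      exact ⟨Or.inl ⟨2 * k + 4 + 3, by omega, by rw [evenWitness_head (by omega), v3]⟩, Or.inr rfl⟩
    · rw [ha', ha]
      exact ⟨Or.inl (exists_evenWitness_eq_lat (by omega)), Or.inl (exists_evenWitness_eq_lat (by omega))⟩

/-- **The both-trapped planar even witness**: detour `0, -e₁, -e₀ - e₁, -e₀`, then the planar even witness;
length `12 + 2k`. [cite: BDGS2012, §1.3] -/
def bothTrappedEvenWitnessTwo (k : ℕ) : ℕ → Site (0 + 2) :=
  detourWalk (evenWitnessTwo k) (-planeVec 0) (spinePt 0 (-1) + -planeVec 0)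

/-- It lies in the escape residual `R(2, 12 + 2k)`. [cite: BDGS2012, §1.3] -/
theorem bothTrappedEvenWitnessTwo_mem_escapeResidual (k : ℕ) :
    bothTrappedEvenWitnessTwo k ∈ escapeResidual (0 + 2) (2 * k + 10 + 2) := by
  have hT := evenWitnessTwo_mem_doublyTrapped k
  obtain ⟨hsaw, htrap, -⟩ := mem_doublyTrapped.1 hT
  obtain ⟨v0, v1, v2, v3, v4, v5, v6⟩ := evenHeadTwo_values
  have hneg : ∀ t, evenWitnessTwo k t ≠ -planeVec 0 ∧ evenWitnessTwo k t ≠ spinePt 0 (-1) + -planeVec 0 :=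
    fun t => by
      have h := planeCoord_evenWitnessTwo_nonneg (k := k) t
      constructor <;> intro e <;> rw [e] at h <;> simp at h
  refine detourWalk_mem_escapeResidual hsaw (by omega) ?_ ?_ ?_ ?_ (fun i _ => (hneg i).1) (fun i _ => (hneg i).2)
    htrap ?_
  · have h := adj_add_planeVec' (m := 0) (-planeVec 0)
    rwa [neg_add_cancel] at h
  · have h := adj_add_spinePt_one' (m := 0) (spinePt 0 (-1) + -planeVec 0)
    rwa [add_right_comm (spinePt 0 (-1)) (-planeVec 0) (spinePt 0 1), spinePt_add,
      show (-1 : ℤ) + 1 = 0 by norm_num, spinePt_zero, zero_add (-planeVec 0)] at h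
  · rw [evenWitnessTwo_head (by omega), v1]
    have h := adj_add_planeVec' (m := 0) (spinePt 0 (-1) + -planeVec 0)
    rw [add_assoc (spinePt 0 (-1)) (-planeVec 0) (planeVec 0), neg_add_cancel, add_zero] at h
    exact h.symm
  · intro e
    have := congrArg (spineCoord 0) e
    simp at this
  · intro a
    rcases single_eq_oddLat (m := 0) a with ⟨-, ha⟩ | ⟨ha1, ha, ha'⟩
    · rw [ha]
      refine ⟨Or.inl ⟨2 * k + 9, by omega, ?_⟩, Or.inl ⟨1, by omega, ?_⟩⟩
      · rw [evenWitnessTwo_back (by omega) le_rfl, show ((2 * k + 10 : ℕ) : ℤ) - ((2 * k + 9 : ℕ) : ℤ) = 1 by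
          push_cast; ring]
      · rw [evenWitnessTwo_head (by omega), v1]; simp only [spinePt, Pi.single_neg]
    · have ha2 : (a : ℕ) = 1 := by have := a.isLt; omega
      have hA : Pi.single a (1 : ℤ) = planeVec 0 := by rw [ha, ha2, Nat.sub_self]; exact oddLat_zero_eq.1
      rw [hA]
      exact ⟨Or.inl ⟨3, by omega, by rw [evenWitnessTwo_head (by omega), v3]⟩, Or.inr rfl⟩

end EvenBoth

/-! ### The escape residual is nonempty at every even `n ≥ 8d - 4` -/

/-- **`R(d, n) ≠ ∅` for every `d ≥ 2` and every even `n ≥ 8d - 4`.** [cite: BDGS2012, §1.3] -/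
theorem escapeResidual_nonempty_of_even {d n : ℕ} (hd : 2 ≤ d) (hn : Even n) (h : 8 * d ≤ n + 4) :
    (escapeResidual d n).Nonempty := by
  obtain ⟨a, ha⟩ := hn
  rcases Nat.lt_or_ge d 3 with hd3 | hd3
  · obtain rfl : d = 2 := by omega
    obtain ⟨k, rfl⟩ : ∃ k, n = 2 * k + 10 + 2 := ⟨(n - 12) / 2, by omega⟩
    exact ⟨_, bothTrappedEvenWitnessTwo_mem_escapeResidual k⟩
  · obtain ⟨m, rfl⟩ : ∃ m, d = m + 1 + 2 := ⟨d - 3, by omega⟩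
    obtain ⟨k, rfl⟩ : ∃ k, n = 2 * k + 8 * m + 18 + 2 := ⟨(n - (8 * m + 20)) / 2, by omega⟩
    exact ⟨_, bothTrappedEvenWitness_mem_escapeResidual m k⟩

/-- At the even threshold: **`R(d, 8d - 4) ≠ ∅` for every `d ≥ 2`** (stated with `n + 4 = 8d`).
[cite: BDGS2012, §1.3] -/
theorem escapeResidual_nonempty_even_threshold {d n : ℕ} (hd : 2 ≤ d) (hn : n + 4 = 8 * d) :
    (escapeResidual d n).Nonempty :=
  escapeResidual_nonempty_of_even hd ⟨4 * d - 2, by omega⟩ (by omega)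

end Literature.Probability.RandomPlanarGeometry.SAW.Zd
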